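import Literature.MathematicalPhysics.QuantumFieldTheory.Balaban1983to89.T4CouplingMatching

/-!
# Spine/NE4/KingCurrencyAF — asymptotic-freedom envelopes along ONE run of (0.20) (helpers for `Spine/NE4/KingCurrencyWindow`)

Cell `pub-balaban-gaps` (YM blitz G2), seat `ne4` generation 13 (unit `pub-balaban-gaps-ne4-g13`), record `HOME/ne/NE4.md` §5 census
item (R51).  Elementary consequences of the tree's `T4CouplingMatching.inv_sq_lower_of_eventualLower` (the discrete lower half of
[Balaban1987RG1] (0.31) along one run, from the eventual lower bound `b ≤ β` — an UNPRINTED binder, `EventualLowerH`): the coupling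
`m` steps above the infrared end of a run is `≤ 1∕√(1∕γ² + b·m)` (`coupling_le_inv_sprof`), that envelope is eventually below any `ε`
(`exists_inv_sprof_le`), and two elementary inequalities used by `KingCurrencyWindow.farUV_le` (the far-ultraviolet term of node U2 in
King's currency is small because the couplings below the infrared window are small).

HONEST FRAMING.  Bookkeeping on hypothesis shapes (0 sorry, standard axioms); nothing of Bałaban's asserted; NE4 NOT IN PRINT ∕ NOT
PROVED; spine PROVED 0∕9; NOT ℝ⁴, NOT infinite volume, NOT a mass gap, NOT Clay.

References (TYPES only): [Balaban1987RG1] = T. Bałaban, Commun. Math. Phys. **109** (1987) 249–301, Thm 2 p. 259, (0.31) p. 259.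
-/

noncomputable section

namespace Summit.QuantumFields.BalabanUV.T4Continuum.Spine.NE4.KingCurrencyAF

open Finset Filter Topology
open Literature.MathematicalPhysics.QuantumFieldTheory.Balaban1983to89
open Literature.MathematicalPhysics.QuantumFieldTheory.Balaban1983to89.FlowStep
open Literature.MathematicalPhysics.QuantumFieldTheory.Balaban1983to89.T4CouplingMatching

/-! ## Asymptotic-freedom envelopes along one run -/

/-- ASYMPTOTIC FREEDOM, POINTWISE: along a run of (0.20) with `N` steps, couplings in `]0,γ]` and the eventual lower bound `b ≤ β`
from scale `k₀` on, the coupling `m = N − i` steps above the infrared end obeys `g_i ≤ 1∕√(1∕γ² + b·(N − i))` for `k₀ ≤ i ≤ N`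
(`inv_sq_lower_of_eventualLower`). [cite: Balaban1987RG1, (0.31) p.259] -/
theorem coupling_le_inv_sprof {β : HBeta} {γ b : ℝ} {k₀ N : ℕ} {g : ℕ → ℝ} (hγ : 0 < γ) (hb : 0 < b)
    (hg : RGEqH N β g) (hbox : ∀ i, i ≤ N → 0 < g i ∧ g i ≤ γ) (hlo : EventualLowerH b γ k₀ β)
    {i : ℕ} (hk : k₀ ≤ i) (hi : i ≤ N) : g i ≤ 1 / sprof γ b (N - i) := by
  have hp0 := sprof_pos hγ hb.le
  have hgi := hbox i hi
  have hgN := hbox N le_rfl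
  have hN : 1 / γ ^ 2 ≤ 1 / (g N) ^ 2 :=
    one_div_le_one_div_of_le (pow_pos hgN.1 2) (pow_le_pow_left₀ hgN.1.le hgN.2 2)
  have h1 := inv_sq_lower_of_eventualLower hg hbox hlo hk hi
  have ha : prof γ b (N - i) ≤ 1 / (g i) ^ 2 := by unfold prof; linarith
  have hsq : (g i) ^ 2 ≤ (1 / sprof γ b (N - i)) ^ 2 := by
    rw [one_div_pow, sprof_sq hγ hb.le, le_one_div (pow_pos hgi.1 2) (prof_pos hγ hb.le _)]
    exact ha
  exact (pow_le_pow_iff_left₀ hgi.1.le (one_div_pos.mpr (hp0 _)).le two_ne_zero).mp hsq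

/-- `m ↦ √(1∕γ² + b·m)` is monotone. [folklore] -/
theorem sprof_monotone {γ b : ℝ} (hb : 0 ≤ b) : Monotone (sprof γ b) :=
  monotone_nat_of_le_succ fun m => sprof_mono hb m

/-- `1∕√(1∕γ² + b·m)` is eventually below any `ε > 0`. [folklore] -/
theorem exists_inv_sprof_le {γ b : ℝ} (hγ : 0 < γ) (hb : 0 < b) {ε : ℝ} (hε : 0 < ε) :
    ∃ D : ℕ, ∀ m : ℕ, D ≤ m → 1 / sprof γ b m ≤ ε := by
  obtain ⟨D, hD⟩ := exists_nat_ge (1 / (b * ε ^ 2))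
  refine ⟨D, fun m hm => ?_⟩
  have hp0 := sprof_pos hγ hb.le m
  have hm' : 1 / (b * ε ^ 2) ≤ (m : ℝ) := hD.trans (by exact_mod_cast hm)
  have hprof : (1 / ε) ^ 2 ≤ prof γ b m := by
    unfold prof
    have h1 : 1 / ε ^ 2 ≤ b * (m : ℝ) := by
      rw [div_le_iff₀ (by positivity)] at hm'
      rw [div_le_iff₀ (by positivity)]
      linarith
    have h2 : 0 ≤ 1 / γ ^ 2 := by positivity
    rw [one_div_pow]
    linarith
  have hle : 1 / ε ≤ sprof γ b m := by
    unfold sprof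
    exact Real.le_sqrt_of_sq_le hprof
  calc 1 / sprof γ b m ≤ 1 / (1 / ε) := one_div_le_one_div_of_le (by positivity) hle
    _ = ε := one_div_one_div ε

/-- Two couplings in `]0,γ]` differ by at most `γ`; two couplings below `a` differ by at most `a`. [folklore] -/
theorem abs_sub_le_of_pos_le {p q a : ℝ} (hp : 0 < p) (hpa : p ≤ a) (hq : 0 < q) (hqa : q ≤ a) : |p - q| ≤ a := by
  rw [abs_sub_le_iff]
  constructor <;> linarith

/-- `Σ_{i<J} θ^{J−i} ≤ θ∕(1−θ)` (`0 ≤ θ < 1`). [folklore] -/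
theorem sum_range_pow_sub_le {θ : ℝ} (hθ0 : 0 ≤ θ) (hθ1 : θ < 1) (J : ℕ) :
    ∑ i ∈ range J, θ ^ (J - i) ≤ θ / (1 - θ) := by
  have hg : ∑ j ∈ range J, θ ^ j ≤ 1 / (1 - θ) := by
    have h : ∑ m ∈ Ico 0 J, θ ^ m ≤ θ ^ 0 / (1 - θ) := geom_sum_Ico_le_of_lt_one hθ0 hθ1
    rw [pow_zero] at h
    rw [Finset.range_eq_Ico]
    exact h
  calc ∑ i ∈ range J, θ ^ (J - i) = ∑ j ∈ range J, θ ^ (j + 1) := by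
        rw [← Finset.sum_range_reflect (fun i => θ ^ (J - i)) J]
        refine Finset.sum_congr rfl fun j hj => ?_
        have hj' : j < J := mem_range.mp hj
        congr 1
        omega
    _ = θ * ∑ j ∈ range J, θ ^ j := by
        rw [Finset.mul_sum]
        refine Finset.sum_congr rfl fun j _ => ?_
        ring
    _ ≤ θ * (1 / (1 - θ)) := mul_le_mul_of_nonneg_left hg hθ0
    _ = θ / (1 - θ) := by ring


end Summit.QuantumFields.BalabanUV.T4Continuum.Spine.NE4.KingCurrencyAF
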